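import Summits.FinalStateConjecture.FinalStateConjecture.Theorems.SwallowTheDatumSubdataDevelopmentsEmbedDoDMain
import Literature.Geometry.Lorentzian.CauchyDevelopment

/-!
# Route SwallowTheDatum · item `SubdataDevelopmentsEmbed` (stmt-FinalStateConjecture-10053) —
# towards the domain of dependence of the sub-datum (`hcauchy`), VIII: the tangency estimate
# for a data embedding, and the local domain-of-dependence lemma for `ι(𝒰)`

* `tangency` — for a data embedding `ι : X → M` with future unit normal `ν`, a point `x₀` and a
  neighbourhood `𝒰` of `x₀`: in the chart `φ` at `p = ι x₀`, with `N̂` the coordinate image of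
  `ν x₀` and `m = Ĝ_{φ p}(N̂, ·)`, for every `ε > 0` there is `δ > 0` such that every `x` with
  `ι x` in the chart domain and `‖φ(ι x) - φ p‖ < δ` lies in `𝒰` and satisfies
  `|m(φ(ι x) - φ p)| ≤ ε ‖φ(ι x) - φ p‖`. Proof: `φ ∘ ι ∘ ψ⁻¹` (`ψ` the chart at `x₀`) is the
  chart expression `writtenInExtChartAt` of `ι`, differentiable at `ψ x₀` with derivative
  `L = dι_{x₀}` (`HasMFDerivAt`); `m ∘ L = 0` since `ν ⊥ dι(TX)`; `L` is injective since
  `g(dι v, dι v) = h(v, v) > 0`, hence bounded below (`LinearMap.exists_antilipschitzWith`);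
  and `ι` is a topological embedding, which localises `x` to the chart domain of `ψ` and to `𝒰`.
* `localDoD_image` — for a Cauchy development `𝒟` and an open `𝒰 ⊆ X`, every point of
  `ι(𝒰)` has a neighbourhood in the domain of dependence of `ι(𝒰)` (`localDoD_of_tangency` of
  `…DoDMain.lean` with `W = ν x₀`).

O'Neill 1983, Ch. 4, pp. 98–107 (hypersurfaces, unit normal), Ch. 1, Prop. 1.32 ff. (chart
expressions of smooth maps); Choquet-Bruhat–Geroch 1969, p. 331 (the domain of dependence of a
portion of the Cauchy surface). No definition, no named fact.
-/

noncomputable section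

open Function Set Filter Topology TopologicalSpace Bundle Manifold
open scoped Manifold ContDiff Topology

namespace Summit.FinalStateConjecture.FinalStateConjecture.Theorems

namespace SubdataDevelopmentsEmbed

open Literature.Geometry.Lorentzian

universe u

section Tangent

variable {k : ℕ} {X : Type u} [TopologicalSpace X] [ChartedSpace (EuclideanSpace ℝ (Fin k)) X]
  [IsManifold (𝓡 k) ∞ X] [ConnectedSpace X] {D : InitialDataSet (𝓡 k) X}

/-- **The tangency estimate for a data embedding** (see the module docstring): in the chart at
`p = ι x₀`, the image `ι(X)` is tangent at `p` to the kernel of `m = Ĝ_{φ p}(N̂, ·)`, `N̂` the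
coordinate image of the unit normal `ν x₀`, quantitatively and with localisation to a given
neighbourhood `𝒰` of `x₀`. -/
theorem tangency (𝒮 : DataEmbedding D) (x₀ : X) {𝒰 : Set X} (h𝒰 : 𝒰 ∈ 𝓝 x₀) {ε : ℝ}
    (hε : 0 < ε) :
    ∃ δ > 0, ∀ x : X,
      𝒮.embed x ∈ (chartAt (EuclideanSpace ℝ (Fin (k + 1))) (𝒮.embed x₀)).source →
      ‖extChartAt (𝓡 (k + 1)) (𝒮.embed x₀) (𝒮.embed x) -
          extChartAt (𝓡 (k + 1)) (𝒮.embed x₀) (𝒮.embed x₀)‖ < δ →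
      x ∈ 𝒰 ∧
        |𝒮.metric.coordMetric (𝒮.embed x₀) (extChartAt (𝓡 (k + 1)) (𝒮.embed x₀) (𝒮.embed x₀))
            ((trivializationAt (EuclideanSpace ℝ (Fin (k + 1))) (TangentSpace (𝓡 (k + 1)))
              (𝒮.embed x₀)).continuousLinearMapAt ℝ (𝒮.embed x₀) (𝒮.normal x₀))
            (extChartAt (𝓡 (k + 1)) (𝒮.embed x₀) (𝒮.embed x) -
              extChartAt (𝓡 (k + 1)) (𝒮.embed x₀) (𝒮.embed x₀))| ≤
          ε * ‖extChartAt (𝓡 (k + 1)) (𝒮.embed x₀) (𝒮.embed x) -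
            extChartAt (𝓡 (k + 1)) (𝒮.embed x₀) (𝒮.embed x₀)‖ := by
  -- notation
  set p : 𝒮.carrier := 𝒮.embed x₀ with hpdef
  set φ := extChartAt (𝓡 (k + 1)) p with hφdef
  set z₀ : EuclideanSpace ℝ (Fin (k + 1)) := φ p with hz₀def
  -- `ê_p` is the identity on `T_p M`
  have hê : ∀ w : TangentSpace (𝓡 (k + 1)) p,
      (trivializationAt (EuclideanSpace ℝ (Fin (k + 1))) (TangentSpace (𝓡 (k + 1)))
        p).continuousLinearMapAt ℝ p w = w := fun w ↦ by
    rw [TangentBundle.continuousLinearMapAt_trivializationAt_eq_core (mem_chart_source _ p)]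
    exact (tangentBundleCore (𝓡 (k + 1)) 𝒮.carrier).coordChange_self (achart _ p) p
      (mem_achart_source _ p) w
  set eT := trivializationAt (EuclideanSpace ℝ (Fin (k + 1))) (TangentSpace (𝓡 (k + 1))) p
    with heT
  set N₀ : EuclideanSpace ℝ (Fin (k + 1)) := eT.continuousLinearMapAt ℝ p (𝒮.normal x₀)
    with hN₀def
  set m : EuclideanSpace ℝ (Fin (k + 1)) →L[ℝ] ℝ := 𝒮.metric.coordMetric p z₀ N₀ with hmdef
  set ψ := extChartAt (𝓡 k) x₀ with hψdef
  have hz₀t : z₀ ∈ φ.target := φ.map_source (mem_extChartAt_source p)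
  have hz₀p : φ.symm z₀ = p := φ.left_inv (mem_extChartAt_source p)
  have hpb : p ∈ eT.baseSet := by simp [heT]
  -- the differential `L = dι_{x₀}` and the chart expression `F = φ ∘ ι ∘ ψ⁻¹`
  have hmd : MDifferentiableAt (𝓡 k) (𝓡 (k + 1)) 𝒮.embed x₀ :=
    𝒮.isSmoothEmbedding.contMDiff.mdifferentiableAt (by simp)
  set L : EuclideanSpace ℝ (Fin k) →L[ℝ] EuclideanSpace ℝ (Fin (k + 1)) :=
    mfderiv (𝓡 k) (𝓡 (k + 1)) 𝒮.embed x₀ with hLdef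
  have hF : HasFDerivAt (writtenInExtChartAt (𝓡 k) (𝓡 (k + 1)) x₀ 𝒮.embed) L (ψ x₀) := by
    have h := hmd.hasMFDerivAt.2
    rw [ModelWithCorners.Boundaryless.range_eq_univ, hasFDerivWithinAt_univ] at h
    exact h
  -- `m(ê w) = g_p(ν, w)`, hence `m ∘ L = 0`
  have hmval : ∀ w : TangentSpace (𝓡 (k + 1)) p,
      m (eT.continuousLinearMapAt ℝ p w) = 𝒮.metric.val p (𝒮.normal x₀) w := by
    intro w
    have hgen : ∀ q : 𝒮.carrier, q = p →
        𝒮.metric.val q (eT.symmL ℝ q N₀) (eT.symmL ℝ q (eT.continuousLinearMapAt ℝ p w)) =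
          𝒮.metric.val p (𝒮.normal x₀) w := by
      rintro q rfl
      rw [hN₀def, eT.symmL_continuousLinearMapAt hpb, eT.symmL_continuousLinearMapAt hpb]
    rw [hmdef, 𝒮.metric.coordMetric_apply hz₀t]
    exact hgen _ hz₀p
  have hmL : ∀ v, m (L v) = 0 := fun v ↦ by
    rw [← hê (L v), hmval]
    exact 𝒮.isFutureUnitNormal.1.1 x₀ v
  -- `L` is injective (the induced metric is Riemannian), hence bounded below
  have hLinj : Injective L := by
    refine (injective_iff_map_eq_zero L).mpr fun v hv ↦ ?_
    by_contra hv0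
    have hpos := D.h.pos x₀ v hv0
    have hind : 𝒮.metric.val p (L v) (L v) = D.h.inner x₀ v v := by
      have := congrArg (fun B ↦ B v v) (𝒮.induced_h x₀)
      simp only [pullbackBilin_apply] at this
      exact this
    have hz : ∀ u : TangentSpace (𝓡 (k + 1)) p, u = 0 → 𝒮.metric.val p u u = 0 := by
      rintro u rfl; simp
    have h0 := hz (L v) hv
    linarith
  obtain ⟨Ka, hKa, hanti⟩ := L.toLinearMap.exists_antilipschitzWith (LinearMap.ker_eq_bot.mpr hLinj)
  have hKv : ∀ v : EuclideanSpace ℝ (Fin k), ‖v‖ ≤ Ka * ‖L v‖ := fun v ↦ by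
    have := hanti.le_mul_dist v 0
    simpa [dist_zero_right] using this
  have hKa' : (0 : ℝ) < Ka := hKa
  -- the little-o estimate at scale `ε₁`
  set ε₁ : ℝ := min (1 / (2 * Ka)) (ε / (2 * Ka * (‖m‖ + 1))) with hε₁def
  have hε₁ : 0 < ε₁ := lt_min (by positivity) (by positivity)
  have hε₁K : Ka * ε₁ ≤ 1 / 2 := by
    have h1 : ε₁ ≤ 1 / (2 * Ka) := min_le_left _ _
    calc Ka * ε₁ ≤ Ka * (1 / (2 * Ka)) := mul_le_mul_of_nonneg_left h1 hKa'.le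
      _ = 1 / 2 := by field_simp
  have hε₁m : ‖m‖ * (ε₁ * (2 * Ka)) ≤ ε := by
    have h1 : ε₁ ≤ ε / (2 * Ka * (‖m‖ + 1)) := min_le_right _ _
    have h2 : ‖m‖ * (ε / (2 * Ka * (‖m‖ + 1)) * (2 * Ka)) ≤ ε := by
      rw [div_mul_eq_mul_div, mul_div_assoc', div_le_iff₀ (by positivity)]
      nlinarith [norm_nonneg m, hε, hKa']
    exact (mul_le_mul_of_nonneg_left (mul_le_mul_of_nonneg_right h1 (by positivity))
      (norm_nonneg _)).trans h2
  obtain ⟨δ₁, hδ₁, hδ₁'⟩ := Metric.eventually_nhds_iff.mp (hF.isLittleO.def hε₁)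
  -- localisation: `ι` is a topological embedding
  have hA : {x : X | x ∈ ψ.source ∧ dist (ψ x) (ψ x₀) < δ₁} ∩ 𝒰 ∈ 𝓝 x₀ := by
    refine inter_mem ?_ h𝒰
    have h1 : ψ.source ∈ 𝓝 x₀ := extChartAt_source_mem_nhds x₀
    have h2 : ψ ⁻¹' Metric.ball (ψ x₀) δ₁ ∈ 𝓝 x₀ :=
      (continuousAt_extChartAt x₀).preimage_mem_nhds (Metric.ball_mem_nhds _ hδ₁)
    filter_upwards [h1, h2] with x hx hx' using ⟨hx, Metric.mem_ball.mp hx'⟩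
  rw [𝒮.isSmoothEmbedding.isEmbedding.toIsInducing.nhds_eq_comap x₀, Filter.mem_comap] at hA
  obtain ⟨Wn, hWn, hWsub⟩ := hA
  have hV : φ.symm ⁻¹' Wn ∈ 𝓝 z₀ := by
    refine (continuousAt_extChartAt_symm p).preimage_mem_nhds ?_
    rw [extChartAt_to_inv]
    exact hWn
  obtain ⟨δ, hδ, hδ'⟩ := Metric.mem_nhds_iff.mp hV
  refine ⟨δ, hδ, fun x hxs hxδ ↦ ?_⟩
  have hx' : 𝒮.embed x ∈ φ.source := by rwa [hφdef, extChartAt_source]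
  have hxW : 𝒮.embed x ∈ Wn := by
    have h1 : φ (𝒮.embed x) ∈ Metric.ball z₀ δ := by rwa [Metric.mem_ball, dist_eq_norm]
    have h2 := hδ' h1
    rwa [mem_preimage, φ.left_inv hx'] at h2
  obtain ⟨⟨hxsrc, hxdist⟩, hx𝒰⟩ := hWsub (show x ∈ 𝒮.embed ⁻¹' Wn from hxW)
  refine ⟨hx𝒰, ?_⟩
  -- the estimate
  have hFξ : writtenInExtChartAt (𝓡 k) (𝓡 (k + 1)) x₀ 𝒮.embed (ψ x) = φ (𝒮.embed x) := by
    simp only [writtenInExtChartAt, comp_apply]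
    rw [← hψdef, ψ.left_inv hxsrc]
  have hFξ₀ : writtenInExtChartAt (𝓡 k) (𝓡 (k + 1)) x₀ 𝒮.embed (ψ x₀) = z₀ := by
    simp only [writtenInExtChartAt, comp_apply]
    rw [← hψdef, ψ.left_inv (mem_extChartAt_source x₀)]
  have hest₀ := hδ₁' hxdist
  rw [hFξ, hFξ₀] at hest₀
  -- hest₀ : ‖φ (ι x) - z₀ - L (ψ x - ψ x₀)‖ ≤ ε₁ * ‖ψ x - ψ x₀‖
  set w : EuclideanSpace ℝ (Fin (k + 1)) := φ (𝒮.embed x) - z₀ with hwdef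
  have hest : ‖w - L (ψ x - ψ x₀)‖ ≤ ε₁ * ‖ψ x - ψ x₀‖ := hest₀
  have h1 : ‖ψ x - ψ x₀‖ ≤ 2 * Ka * ‖w‖ := by
    have hK := hKv (ψ x - ψ x₀)
    have hL' : ‖L (ψ x - ψ x₀)‖ ≤ ‖w‖ + ε₁ * ‖ψ x - ψ x₀‖ := by
      have h5 := norm_le_insert' (L (ψ x - ψ x₀)) w
      rw [norm_sub_rev (L (ψ x - ψ x₀)) w] at h5
      linarith
    have h3 : ‖ψ x - ψ x₀‖ ≤ Ka * ‖w‖ + Ka * ε₁ * ‖ψ x - ψ x₀‖ := by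
      calc ‖ψ x - ψ x₀‖ ≤ Ka * ‖L (ψ x - ψ x₀)‖ := hK
        _ ≤ Ka * (‖w‖ + ε₁ * ‖ψ x - ψ x₀‖) := mul_le_mul_of_nonneg_left hL' hKa'.le
        _ = Ka * ‖w‖ + Ka * ε₁ * ‖ψ x - ψ x₀‖ := by ring
    have h4 : Ka * ε₁ * ‖ψ x - ψ x₀‖ ≤ 1 / 2 * ‖ψ x - ψ x₀‖ :=
      mul_le_mul_of_nonneg_right hε₁K (norm_nonneg _)
    linarith
  have h2 : m w = m (w - L (ψ x - ψ x₀)) := by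
    rw [map_sub m w (L (ψ x - ψ x₀)), hmL, sub_zero]
  calc |m w| = ‖m (w - L (ψ x - ψ x₀))‖ := by rw [h2, Real.norm_eq_abs]
    _ ≤ ‖m‖ * ‖w - L (ψ x - ψ x₀)‖ := m.le_opNorm _
    _ ≤ ‖m‖ * (ε₁ * ‖ψ x - ψ x₀‖) := mul_le_mul_of_nonneg_left hest (norm_nonneg _)
    _ ≤ ‖m‖ * (ε₁ * (2 * Ka * ‖w‖)) :=
        mul_le_mul_of_nonneg_left (mul_le_mul_of_nonneg_left h1 hε₁.le) (norm_nonneg _)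
    _ = ‖m‖ * (ε₁ * (2 * Ka)) * ‖w‖ := by ring
    _ ≤ ε * ‖w‖ := mul_le_mul_of_nonneg_right hε₁m (norm_nonneg _)

/-- **The local domain-of-dependence lemma for `ι(𝒰)`.** For a Cauchy development `𝒟` of data
on `X` and an open `𝒰 ⊆ X`, every point of `ι(𝒰)` has a neighbourhood `O` such that every
endless timelike curve through a point of `O` meets `ι(𝒰)`: `localDoD_of_tangency` at
`p = ι x₀` with `W = ν x₀` (future unit normal), the tangency estimate `tangency` supplying both
hypotheses. Choquet-Bruhat–Geroch 1969, p. 331; O'Neill 1983, Ch. 14, Lemma 14.43. -/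
theorem localDoD_image (𝒟 : CauchyDevelopment D) {𝒰 : Set X} (h𝒰 : IsOpen 𝒰) :
    ∀ q ∈ 𝒟.embed '' 𝒰, ∃ O ∈ 𝓝 q, ∀ p ∈ O, ∀ (γ : ℝ → 𝒟.carrier) (u : Set ℝ),
      𝒟.metric.IsEndlessTimelikeCurve 𝒟.timeOrientation γ u → ∀ r ∈ u, γ r = p →
        ∃ r' ∈ u, γ r' ∈ 𝒟.embed '' 𝒰 := by
  rintro q ⟨x₀, hx₀, rfl⟩
  have hn : (2 : ℕ∞ω) ≤ ∞ := WithTop.coe_le_coe.mpr le_top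
  have hν := 𝒟.isFutureUnitNormal
  refine localDoD_of_tangency hn 𝒟.isCauchyHypersurface (mem_range_self x₀) (W := 𝒟.normal x₀)
    ?_ (hν.2 x₀) ?_ ?_
  · rw [LorentzianMetric.isTimelike_iff, hν.1.2 x₀]
    norm_num
  · intro ε hε
    obtain ⟨δ, hδ, h⟩ := tangency 𝒟.toDataEmbedding x₀ (h𝒰.mem_nhds hx₀) hε
    refine ⟨δ, hδ, ?_⟩
    rintro q ⟨x, rfl⟩ hsrc hdist
    exact (h x hsrc hdist).2
  · obtain ⟨δ, hδ, h⟩ := tangency 𝒟.toDataEmbedding x₀ (h𝒰.mem_nhds hx₀) one_pos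
    refine ⟨δ, hδ, ?_⟩
    rintro q ⟨x, rfl⟩ hsrc hdist
    exact ⟨x, (h x hsrc hdist).1, rfl⟩

end Tangent

end SubdataDevelopmentsEmbed

end Summit.FinalStateConjecture.FinalStateConjecture.Theorems

end
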